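import Summits.QuantumAdvantage.QuantumAdvantage.Theorems.LinnikCubicClassGroupsDegreeOnePrimesEscapeClassPNTSiegel
import Literature.NumberTheory.LFunctions.ClassGroupLFunctionExceptionalZeroEffective
import HarnessLib

/-!
# The class prime number theorem with no exceptional term in EVERY degree, EFFECTIVELY:
# Stark's range `x ≥ exp(c·|d_K|^{1/n}(log|d_K|)²)` and an effective least prime ideal in every class

Topic `Summits/QuantumAdvantage/QuantumAdvantage/Theorems`, cell B2b-1 (linnik-cubic), PART A seat 5;
helper for the crux `DegreeOnePrimesEscape` (stmt-QuantumAdvantage-11543) of route `LinnikCubicClassGroups`.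
HONEST FRAMING: the value of this file is a THEOREM (kernel-checked, GRH-free, no ineffective input) — NOT
summit progress (the route still rests on the hypothesis-type target `PureCubicClassNumberHard`).

The engine `classPNT_eps_of_zeroRepulsion` of `…ClassPNTSiegel.lean` (a repulsion bound `β₁ ≤ 1 − 1/log R`
for the possible exceptional zero removes the exceptional term for `x ≥ Q^{c₁}`, `x ≥ R^{c₀}`) fed with the
EFFECTIVE repulsion of `ClassGroupLFunctionExceptionalZeroEffective.lean`
(`classGroupLFunction_one_sub_realZero_ge'`: `1 − β₁ ≥ min(1/(8(2n)! log|d_K|), c|d_K|^{−1/n}(log|d_K|)^{−2})`,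
absolute `c`, via Stark's descent to a quadratic Dirichlet character and Montgomery–Vaughan (11.10)):

* `classPNT_eps_effectiveRange (n) (ε)` — **for `n > 1`, `ε > 0` there is `c₁ > 0` such that for EVERY
  number field `K` of degree `n`, every ideal class `C` and all `x ≥ Q^{c₁}` with
  `x ≥ exp(c₁·|d_K|^{1/n}(log|d_K|)²)`: `|π_C(x) − Li(x)/h_K| ≤ ε·Li(x)/h_K`** — the range IMPROVES with
  the degree (`|d_K|^{1/2}` for quadratic fields, `|d_K|^{1/n}` in degree `n`);
* `exists_prime_mem_class_absNorm_le_effective (n)` — every ideal class of every number field of degree `n`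
  contains a prime ideal of norm `≤ exp(L(n)·|d_K|^{1/n}(log|d_K|)²)` (in odd degree the tree has `Q^{L}`,
  `exists_prime_mem_class_absNorm_le_of_odd`; in even degree Weiss's `Q^{L}` needs Deuring–Heilbronn).

## References

* H. M. Stark, *Some effective cases of the Brauer–Siegel theorem*, Invent. Math. 23 (1974) 135–152, §1,
  Thm. 1, Thm. 3. [Stark1974]
* H. L. Montgomery, R. C. Vaughan, *Multiplicative Number Theory I*, CUP 2007, Theorem 11.4 (11.10).
  [MontgomeryVaughan2007]
* A. Weiss, *The least prime ideal*, J. reine angew. Math. 338 (1983) 56–94, Theorem 5.2. [Weiss1983]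
-/

noncomputable section

open Complex Real MeasureTheory Set Filter Topology
open scoped NumberField nonZeroDivisors

namespace Summit.QuantumAdvantage.QuantumAdvantage.Theorems.DegreeOnePrimesEscape

open Literature.NumberTheory.LFunctions Literature.NumberTheory.LFunctions.NumberField
  Literature.NumberTheory.LFunctions.AbelianDensity

/-- **Effective class PNT with no exceptional term, every number field of degree `n`** (unconditional, no
Siegel-type ineffectivity): for `n > 1` and `ε > 0` there is `c₁ > 0` such that for every number field `K` of
degree `n`, every ideal class `C` and every `x` with `x ≥ Q^{c₁}` and `x ≥ exp(c₁·|d_K|^{1/n}·(log|d_K|)²)`: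
`|π_C(x) − Li(x)/h_K| ≤ ε·Li(x)/h_K`.  (Engine + the effective repulsion
`classGroupLFunction_one_sub_realZero_ge'`: `1 − β₁ ≥ min(1/(8(2n)! log|d_K|), c|d_K|^{−1/n}(log|d_K|)^{−2})`,
with `R = exp(max(8(2n)!·log|d_K|, |d_K|^{1/n}(log|d_K|)²/c))`.) [cite: Stark1974, Thm. 1 and §1]
[cite: MontgomeryVaughan2007, Theorem 11.4 (11.10)] -/
theorem classPNT_eps_effectiveRange (n : ℕ) (hn : 1 < n) {ε : ℝ} (hε : 0 < ε) :
    ∃ c₁ : ℝ, 0 < c₁ ∧ ∀ (K : Type) [Field K] [NumberField K], Module.finrank ℚ K = n →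
      ∀ (C : ClassGroup (𝓞 K)) (x : ℝ), ThornerZaman.condQn K ^ c₁ ≤ x →
        Real.exp (c₁ * ((NumberField.discr K).natAbs : ℝ) ^ ((1 : ℝ) / n) *
          Real.log ((NumberField.discr K).natAbs : ℝ) ^ 2) ≤ x →
          |(primeIdealClassCount K C x : ℝ) - offsetLogIntegral x / NumberField.classNumber K| ≤
            ε * offsetLogIntegral x / NumberField.classNumber K := by
  classical
  obtain ⟨c₁, c₀, hc₁, hc₀, h⟩ := classPNT_eps_of_zeroRepulsion n hn hε
  obtain ⟨c, hc, hZ⟩ := classGroupLFunction_one_sub_realZero_ge'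
  have hfac0 : (0 : ℝ) < ((2 * n).factorial : ℝ) := by exact_mod_cast Nat.factorial_pos _
  refine ⟨max (max c₁ (c₀ * (8 * ((2 * n).factorial : ℝ)))) (c₀ / c),
    lt_max_of_lt_left (lt_max_of_lt_left hc₁), fun K _ _ hKn Cl x hx hxe => ?_⟩
  have hK : 1 < Module.finrank ℚ K := by rw [hKn]; exact hn
  set Q : ℝ := ThornerZaman.condQn K with hQ
  have hQ12 : (12 : ℝ) ≤ Q := ThornerZaman.twelve_le_condQn (K := K) hK
  have hQ1 : (1 : ℝ) < Q := by linarith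
  set d : ℝ := ((NumberField.discr K).natAbs : ℝ) with hd
  have hd3 : (3 : ℝ) ≤ d := by
    have h2 := NumberField.abs_discr_gt_two hK
    rw [hd, Nat.cast_natAbs]
    exact_mod_cast (show (3 : ℤ) ≤ |NumberField.discr K| by omega)
  have hlog3 : 1 < Real.log 3 := by
    rw [← Real.log_exp 1]
    refine Real.log_lt_log (Real.exp_pos 1) ?_
    have := Real.exp_one_lt_d9; linarith
  have hlogd : 1 < Real.log d := hlog3.trans_le (Real.log_le_log (by norm_num) hd3)
  have hlogd0 : 0 < Real.log d := by linarith
  have hdQ : Real.log d ≤ Real.log Q := by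
    refine Real.log_le_log (by linarith) ?_
    rw [hd, Nat.cast_natAbs, Int.cast_abs]
    exact ThornerZaman.abs_discr_le_condQn K
  have hdn : 0 < d ^ ((1 : ℝ) / n) := Real.rpow_pos_of_pos (by linarith) _
  -- the repulsion parameter `R = exp(B)`, `B = max (8(2n)! log d) (d^{1/n} log² d / c)`
  set B : ℝ := max (8 * ((2 * n).factorial : ℝ) * Real.log d) (d ^ ((1 : ℝ) / n) * Real.log d ^ 2 / c) with hB
  have hfac1 : (1 : ℝ) ≤ ((2 * n).factorial : ℝ) := by exact_mod_cast Nat.succ_le_of_lt (Nat.factorial_pos _)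
  have hB8 : 8 * ((2 * n).factorial : ℝ) * Real.log d ≤ B := le_max_left _ _
  have hB3 : (3 : ℝ) ≤ B := by nlinarith
  have hB0 : 0 < B := by linarith
  set R : ℝ := Real.exp B with hR
  have hlogR : Real.log R = B := by rw [hR, Real.log_exp]
  have hR12 : (12 : ℝ) ≤ R := by
    have h3 : Real.exp 3 ≤ R := Real.exp_le_exp.mpr hB3
    have he : (12 : ℝ) ≤ Real.exp 3 := by
      have h9 : Real.exp 3 = Real.exp 1 ^ 3 := by
        rw [← Real.exp_nat_mul]; norm_num
      have h1 : (2.7182818283 : ℝ) ≤ Real.exp 1 := Real.exp_one_gt_d9.le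
      have h27 : (2.7182818283 : ℝ) ^ 3 ≤ Real.exp 1 ^ 3 := pow_le_pow_left₀ (by norm_num) h1 3
      rw [h9]
      exact le_trans (by norm_num) h27
    linarith
  have hrep : ∀ χ : ClassGroup (𝓞 K) →* ℂˣ, χ * χ = 1 → ∀ β : ℝ,
      1 - 1 / (8 * Real.log (ThornerZaman.condQn K)) < β → β < 1 →
        classGroupLFunction K χ β = 0 → β ≤ 1 - 1 / Real.log R := by
    intro χ hχ β _ hβ1 hz
    have hm := hZ K hK χ hχ β hβ1 hz
    rw [hKn] at hm
    -- `1/B ≤ min (1/(8(2n)! log d)) (c d^{-1/n}/log² d)`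
    have hinv : d ^ (-(1 : ℝ) / n) = (d ^ ((1 : ℝ) / n))⁻¹ := by
      rw [← Real.rpow_neg (by linarith)]; congr 1; ring
    have h1 : 1 / B ≤ 1 / (8 * ((2 * n).factorial : ℝ) * Real.log d) :=
      one_div_le_one_div_of_le (by positivity) hB8
    have h2 : 1 / B ≤ c * d ^ (-(1 : ℝ) / n) / Real.log d ^ 2 := by
      have hle : d ^ ((1 : ℝ) / n) * Real.log d ^ 2 / c ≤ B := le_max_right _ _
      have hpos : 0 < d ^ ((1 : ℝ) / n) * Real.log d ^ 2 / c := by positivity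
      calc 1 / B ≤ 1 / (d ^ ((1 : ℝ) / n) * Real.log d ^ 2 / c) := one_div_le_one_div_of_le hpos hle
        _ = c * d ^ (-(1 : ℝ) / n) / Real.log d ^ 2 := by rw [hinv]; field_simp
    have h3 : 1 / Real.log R ≤ 1 - β := by
      rw [hlogR]
      exact (le_min h1 h2).trans hm
    linarith
  refine h K hKn R hR12 hrep Cl x ?_ ?_
  · exact (Real.rpow_le_rpow_of_exponent_le hQ1.le ((le_max_left _ _).trans (le_max_left _ _))).trans hx
  · -- `R^{c₀} = exp(c₀ B) ≤ x`
    rw [hR, ← Real.exp_mul]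
    rcases le_total (d ^ ((1 : ℝ) / n) * Real.log d ^ 2 / c) (8 * ((2 * n).factorial : ℝ) * Real.log d)
      with hle | hle
    · rw [hB, max_eq_left hle]
      -- `exp(8(2n)! c₀ log d) = d^{8(2n)! c₀} ≤ Q^{c₁'} ≤ x`
      have h2 : Q ^ (c₀ * (8 * ((2 * n).factorial : ℝ))) ≤ x :=
        (Real.rpow_le_rpow_of_exponent_le hQ1.le ((le_max_right _ _).trans (le_max_left _ _))).trans hx
      have h3 : Real.exp (8 * ((2 * n).factorial : ℝ) * Real.log d * c₀) ≤
          Q ^ (c₀ * (8 * ((2 * n).factorial : ℝ))) := by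
        rw [Real.rpow_def_of_pos (by linarith), Real.exp_le_exp]
        have : 8 * ((2 * n).factorial : ℝ) * Real.log d * c₀ = (c₀ * (8 * ((2 * n).factorial : ℝ))) * Real.log d := by
          ring
        rw [this, mul_comm (Real.log Q)]
        exact mul_le_mul_of_nonneg_left hdQ (by positivity)
      exact h3.trans h2
    · rw [hB, max_eq_right hle]
      have h2 : Real.exp (d ^ ((1 : ℝ) / n) * Real.log d ^ 2 / c * c₀) ≤
          Real.exp (max (max c₁ (c₀ * (8 * ((2 * n).factorial : ℝ)))) (c₀ / c) * d ^ ((1 : ℝ) / n) *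
            Real.log d ^ 2) := by
        rw [Real.exp_le_exp]
        have : d ^ ((1 : ℝ) / n) * Real.log d ^ 2 / c * c₀ = c₀ / c * (d ^ ((1 : ℝ) / n) * Real.log d ^ 2) := by
          ring
        rw [this, mul_assoc]
        exact mul_le_mul_of_nonneg_right (le_max_right _ _) (by positivity)
      exact h2.trans hxe

/-- **Effective least prime ideal in an ideal class, every number field of degree `n`** (unconditional, no
Siegel / GRH / Deuring–Heilbronn input): for `n > 1` there is an effective `L > 0` such that every ideal class
of every number field `K` of degree `n` contains a prime ideal of norm
`≤ exp(L · |d_K|^{1/n} · (log|d_K|)²)`.  (From `classPNT_eps_effectiveRange` at `ε = 1/2`; `Q^{c₁}` is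
absorbed since `log Q = log|d_K| + n log n ≤ (1 + n log n) log|d_K|`.  For odd `n` the tree has the much
stronger `Q^{L}`, `exists_prime_mem_class_absNorm_le_of_odd`; in even degree Weiss's `Q^{L}` [Weiss1983]
needs Deuring–Heilbronn, not in the tree.) [cite: Stark1974, §1] [cite: Weiss1983, Theorem 5.2 (cf.)] -/
theorem exists_prime_mem_class_absNorm_le_effective (n : ℕ) (hn : 1 < n) :
    ∃ L : ℝ, 0 < L ∧ ∀ (K : Type) [Field K] [NumberField K], Module.finrank ℚ K = n →
      ∀ C : ClassGroup (𝓞 K), ∃ (P : Ideal (𝓞 K)) (hP : P ∈ (Ideal (𝓞 K))⁰), P.IsPrime ∧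
        ClassGroup.mk0 ⟨P, hP⟩ = C ∧ (Ideal.absNorm P : ℝ) ≤
          Real.exp (L * ((NumberField.discr K).natAbs : ℝ) ^ ((1 : ℝ) / n) *
            Real.log ((NumberField.discr K).natAbs : ℝ) ^ 2) := by
  classical
  obtain ⟨c₁, hc₁, h⟩ := classPNT_eps_effectiveRange n hn (by norm_num : (0:ℝ) < 1 / 2)
  have hnlog : 0 ≤ (n : ℝ) * Real.log n := by
    have : (1 : ℝ) ≤ n := by exact_mod_cast hn.le
    exact mul_nonneg (by positivity) (Real.log_nonneg this)
  refine ⟨max c₁ 1 * (1 + n * Real.log n), by positivity, fun K _ _ hKn C => ?_⟩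
  have hK : 1 < Module.finrank ℚ K := by rw [hKn]; exact hn
  set Q : ℝ := ThornerZaman.condQn K with hQ
  have hQ12 : (12 : ℝ) ≤ Q := ThornerZaman.twelve_le_condQn (K := K) hK
  have hQ1 : (1 : ℝ) < Q := by linarith
  set d : ℝ := ((NumberField.discr K).natAbs : ℝ) with hd
  have hd3 : (3 : ℝ) ≤ d := by
    have h2 := NumberField.abs_discr_gt_two hK
    rw [hd, Nat.cast_natAbs]
    exact_mod_cast (show (3 : ℤ) ≤ |NumberField.discr K| by omega)
  have hd0 : 0 < d := by linarith
  have hlog3 : 1 < Real.log 3 := by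
    rw [← Real.log_exp 1]
    refine Real.log_lt_log (Real.exp_pos 1) ?_
    have := Real.exp_one_lt_d9; linarith
  have hlogd : 1 < Real.log d := hlog3.trans_le (Real.log_le_log (by norm_num) hd3)
  have hdn1 : 1 ≤ d ^ ((1 : ℝ) / n) := Real.one_le_rpow (by linarith) (by positivity)
  -- `log Q = log d + n log n ≤ (1 + n log n) log d`
  have hQeq : Q = d * (n : ℝ) ^ n := by
    rw [hQ, ThornerZaman.condQn, hKn, hd, Nat.cast_natAbs, Int.cast_abs]
  have hn0 : (0 : ℝ) < n := by exact_mod_cast (show 0 < n by omega)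
  have hlogQ : Real.log Q = Real.log d + n * Real.log n := by
    rw [hQeq, Real.log_mul (by linarith) (by positivity), Real.log_pow]
  have hlogQle : Real.log Q ≤ (1 + n * Real.log n) * Real.log d := by
    rw [hlogQ]; nlinarith
  -- the point `x = exp(L d^{1/n} log² d)`
  set L : ℝ := max c₁ 1 * (1 + n * Real.log n) with hL
  set x : ℝ := Real.exp (L * d ^ ((1 : ℝ) / n) * Real.log d ^ 2) with hx
  have hL1 : 1 + n * Real.log n ≤ L := by
    rw [hL]; nlinarith [le_max_right c₁ 1]
  have hLc : c₁ ≤ L := by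
    rw [hL]; nlinarith [le_max_left c₁ 1]
  have hbig : Real.log d ≤ d ^ ((1 : ℝ) / n) * Real.log d ^ 2 := by nlinarith
  have hQx : Q ^ (max c₁ 1) ≤ x := by
    rw [Real.rpow_def_of_pos (by linarith), hx, Real.exp_le_exp]
    calc Real.log Q * max c₁ 1 ≤ (1 + n * Real.log n) * Real.log d * max c₁ 1 :=
          mul_le_mul_of_nonneg_right hlogQle (by positivity)
      _ = L * Real.log d := by rw [hL]; ring
      _ ≤ L * (d ^ ((1 : ℝ) / n) * Real.log d ^ 2) := mul_le_mul_of_nonneg_left hbig (by positivity)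
      _ = L * d ^ ((1 : ℝ) / n) * Real.log d ^ 2 := by ring
  have hx₁ : Q ^ c₁ ≤ x := (Real.rpow_le_rpow_of_exponent_le hQ1.le (le_max_left _ _)).trans hQx
  have hxQ : Q ≤ x := by
    have := Real.rpow_le_rpow_of_exponent_le hQ1.le (le_max_right c₁ 1)
    rw [Real.rpow_one] at this
    exact this.trans hQx
  have hxe : Real.exp (c₁ * d ^ ((1 : ℝ) / n) * Real.log d ^ 2) ≤ x := by
    rw [hx, Real.exp_le_exp]
    have : 0 ≤ d ^ ((1 : ℝ) / n) * Real.log d ^ 2 := by positivity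
    nlinarith
  have hx2 : (2 : ℝ) < x := by linarith
  have hlogx : 0 < Real.log x := Real.log_pos (by linarith)
  have hLi : 0 < offsetLogIntegral x := by
    have h1 := sub_mul_inv_log_pow_le_offsetLogIntegralPow 1 hx2.le
    rw [pow_one, offsetLogIntegralPow_one] at h1
    exact lt_of_lt_of_le (mul_pos (by linarith) (inv_pos.mpr hlogx)) h1
  set hK' : ℝ := (NumberField.classNumber K : ℝ) with hh
  have hh0 : 0 < hK' := by
    rw [hh]; exact_mod_cast Nat.lt_of_lt_of_le Nat.zero_lt_one (one_le_classNumber (K := K))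
  have hbound := h K hKn C x hx₁ hxe
  have hpos : 0 < (primeIdealClassCount K C x : ℝ) := by
    have h1 := (abs_sub_le_iff.mp hbound).2
    have h2 : 0 < offsetLogIntegral x / hK' - 1 / 2 * offsetLogIntegral x / hK' := by
      rw [← sub_div, show offsetLogIntegral x - 1 / 2 * offsetLogIntegral x = offsetLogIntegral x / 2 by ring]
      positivity
    linarith
  have hne : primeIdealClassCount K C x ≠ 0 := by
    intro h0; rw [h0, Nat.cast_zero] at hpos; exact lt_irrefl _ hpos
  obtain ⟨P, hPprime, hPx, hP0, hPC⟩ := Set.nonempty_of_ncard_ne_zero hne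
  exact ⟨P, hP0, hPprime, hPC, hPx⟩

end Summit.QuantumAdvantage.QuantumAdvantage.Theorems.DegreeOnePrimesEscape

end
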